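import Literature.NumberTheory.Transcendental.TaylorSeriesPadic
import Literature.NumberTheory.Irrationality.LaiSprangZudilin2026.PartialFractions
import HarnessLib

/-!
# Lai–Sprang–Zudilin 2026, Lemma 5.3 (I): the `p`-scaled Taylor series of `R_n(t)(t+k)^4` at its poles, modulo `p`

Topic `Literature/NumberTheory/Irrationality/LaiSprangZudilin2026`.  Source: L. Lai, J. Sprang, W. Zudilin,
*A note on the irrationality of `ζ₂(5)`*, IMRN **2026**:16, rnag180 = arXiv:2505.05005 [LaiSprangZudilin2026],
§5, Lemma 5.3 (held text `paper:arxiv-2505.05005`, p0008–p0009, read on the page):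
«Lemma 5.3. For any prime `p > max{√(2n), 3}`, we have `v_p(ρ_{n,0}) ≥ −5`.»  The PRINTED proof transforms the
`ℓ`-th partial sum of (def_rho_0) into a very-well-poised `₁₃V₁₂` and applies «the Andrews transformation [KR2007]»
to a quadruple sum, then reads `p`-adic orders factor by factor («for trivial reasons we always have
`v_p(F|_{ε=0}) ≥ −3` … the stronger statement `≥ −2`», followed by «the induction argument as in [Zud2004]»).
The Andrews/`₁₃V₁₂` layer is not in the tree; this file and `LemmaFiveThree.lean` give instead an ELEMENTARY proof
(the cell `zeta5-irr`'s THEOREM DC-2 road, zi-p2 memo `probes/DC/thm-dc2/THEOREM-DC2.md` L1–L6, refereed zi-ref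
R6.94), reorganised around the exact `p`-scaled Taylor series of `Transcendental/TaylorSeriesPadic.lean`.

## What is proved here (everything PROVED; no named fact; `p` an odd prime, `k ≤ n`, `2n < p²`)

Write `𝒯_k := pTaylor p (R_n(t)(t+k)^4) (−k) = Σ_j p^j r_{n,4−j,k} X^j ∈ ℚ⟦X⟧` (`coeff_pTaylor_Rreg`; the tree's
`coeffR n i k = r_{n,i,k}` of `PartialFractions.lean`).
* `pTaylor_Rreg`, `TF_eq`: `𝒯_k = (C(n−2k) + 2pX)·TF^4` EXACTLY, where `TF = pTaylor(2^{2n}(t+½)_n/n!)·pTaylor(n!(t+k)/(t)_{n+1})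
  = C(2^{2n})·C(p^{s₁}p^{−s₂})·𝒰·ℳ` with `𝒰` the product of the unit factors (`C(m−k+½) + pX`, `invLin p (l−k)`,
  `p ∤`), `ℳ = ∏_{sing. zeros}(C β' + X)·∏_{sing. poles} invLin 1 β` the singular factors with their `p` extracted,
  `s₁ = #singN` (`m < n`, `2m+1 ≡ 2k (mod p)`), `s₂ = #singD` (`l ≠ k`, `l ≡ k (mod p)`); `𝒰 ≡ C(u)`,
  `𝒰, ℳ` `p`-integral (`Upart_psOrdGe`, `Mpart_psOrdGe`, `padicOrdGe_mval`).
* `singN_eq`, `singD_eq`, `card_singN_eq`: the singular sets in digit coordinates (`p = 2h+1`): `singD = {k ∓ (j+1)p}`,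
  `singN = {k+h−(j+1)p} ∪ {k+h+jp}`, so `s₁ − s₂ = [k mod p > h] + [(n−k) mod p > h] ≥ 0` — the pole is GOOD
  (`Good p n k`: both last digits `≤ h`, no carry in `k + k` and `(n−k)+(n−k)`) iff `s₁ = s₂`.
* `halfBrick_mul_Greg`: the value identity `F_k(−k) = binom(2k,k)·binom(2n−2k,n−k) =: A_k` (`Aval`).
* `pTaylor_Rreg_congr`: **`𝒯_k` is `p`-integral, and `𝒯_k ≡ C((n−2k)·A_k^4)·Λ(k/p) (mod p)`**, where
  `Λ(q) = Lam p n q` (the normalised `ℳ^4` in digit coordinates, `Mstar`) depends on `k` only through its leading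
  digit `q = ⌊k/p⌋` and is `p`-integral (`psOrdGe_Lam`); at a BAD pole both sides are `≡ 0` (`p ∣ A_k` by
  Kummer/Lucas, `dvd_centralBinom_of_digit`; `centralBinom_modEq_of_digit` is Lucas for a good digit).
The window argument over `k` and the discharge `lemma53_holds` are in `LemmaFiveThree.lean`.

HONEST FRAMING (cell zeta5-irr, rung F-Z1): `p`-adic bookkeeping for a published lemma about the 2-adic `ζ₂(5)`
linear forms; nothing here concerns `ζ(5)`, and (5.2) «den-con» is NOT proved.
-/

noncomputable section

namespace Literature.NumberTheory.Irrationality.LaiSprangZudilin2026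

open Finset Filter PowerSeries Literature.Analysis.Calculus Literature.NumberTheory.Transcendental
open Literature.NumberTheory.Irrationality.RivoalZudilin2020 (halfBrick Greg Greg_eq)
open scoped Nat

namespace Lemma53

variable {p : ℕ}

/-! ### The factors of `R_n(t)(t+k)^4` at `t = −k` -/

/-- The index set of the inverse factors of `G(t)(t+k) = n!/∏_{l ≤ n, l ≠ k}(t+l)`. [cite: LaiSprangZudilin2026, §5 (G(t) = n!/(t)_{n+1})] -/
def poles (n k : ℕ) : Finset ℕ := (range (n + 1)).filter (fun l => l ≠ k)

/-- The value `m − k + ½` of the factor `t + ½ + m` of `(t+½)_n` at `t = −k`. [cite: LaiSprangZudilin2026, §5 (F(t) = 2^{2n}(t+½)_n/n!)] -/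
def wN (k m : ℕ) : ℚ := (m : ℚ) - k + 1 / 2

/-- The value `l − k` of the factor `t + l` of `(t)_{n+1}` at `t = −k`. [cite: LaiSprangZudilin2026, §5 (G(t) = n!/(t)_{n+1})] -/
def wD (k l : ℕ) : ℚ := (l : ℚ) - k

/-- `pTaylor` of the half-integer brick at `−k`: `C(2^{2n}/n!) · ∏_{m<n} (C(m−k+½) + pX)`.
[cite: LaiSprangZudilin2026, §5 (F(t))] -/
theorem pTaylor_halfBrick (n k : ℕ) :
    pTaylor p (halfBrick 0 n) (-(k : ℚ)) =
      C ((2 : ℚ) ^ (2 * n) / (n ! : ℚ)) * ∏ m ∈ range n, (C (wN k m) + C (p : ℚ) * X) := by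
  have e : halfBrick 0 n = fun t : ℚ =>
      (fun _ : ℚ => (2 : ℚ) ^ (2 * n) / (n ! : ℚ)) t * (fun t : ℚ => ∏ j ∈ range n, (t + (((0 : ℤ) : ℚ) + 1 / 2 + j))) t := by
    funext t; rfl
  have hlin : ∀ j ∈ range n, ContDiffAt ℚ (⊤ : ℕ∞) (fun t : ℚ => t + (((0 : ℤ) : ℚ) + 1 / 2 + j)) (-(k : ℚ)) :=
    fun j _ => contDiffAt_id.add contDiffAt_const
  rw [e, pTaylor_fun_mul contDiffAt_const (contDiffAt_prod hlin), pTaylor_const, pTaylor_fun_prod _ hlin]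
  congr 1
  refine prod_congr rfl fun m _ => ?_
  rw [pTaylor_add_const, wN]
  congr 2
  push_cast; ring

/-- `pTaylor` of `G(t)(t+k)` at `−k` (`k ≤ n`): `C(n!) · ∏_{l ≤ n, l ≠ k} invLin p (l − k)`.
[cite: LaiSprangZudilin2026, §5 (G(t))] -/
theorem pTaylor_Greg (n : ℕ) {k : ℕ} (hk : k ≤ n) :
    pTaylor p (Greg n k) (-(k : ℚ)) = C (n ! : ℚ) * ∏ l ∈ poles n k, invLin p (wD k l) := by
  have e : Greg n k = fun t : ℚ =>
      (fun _ : ℚ => (n ! : ℚ)) t * (fun t : ℚ => ∏ l ∈ poles n k, (t + l)⁻¹) t := by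
    funext t; rw [Greg_eq n hk t]; rfl
  have hne : ∀ l ∈ poles n k, (-(k : ℚ)) + l ≠ 0 := by
    intro l hl h
    have hlk : l ≠ k := (mem_filter.1 hl).2
    have : (l : ℚ) = k := by linarith
    exact hlk (by exact_mod_cast this)
  have hinv : ∀ l ∈ poles n k, ContDiffAt ℚ (⊤ : ℕ∞) (fun t : ℚ => (t + l)⁻¹) (-(k : ℚ)) :=
    fun l hl => contDiffAt_inv_add_const (hne l hl)
  rw [e, pTaylor_fun_mul contDiffAt_const (contDiffAt_prod hinv), pTaylor_const, pTaylor_fun_prod _ hinv]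
  congr 1
  refine prod_congr rfl fun l hl => ?_
  rw [pTaylor_inv_add_const p (hne l hl), wD]
  congr 1; ring

/-- Smoothness of the half-integer brick. [cite: LaiSprangZudilin2026, §5 (proof of Lemma 5.3)] -/
theorem contDiffAt_halfBrick' (n : ℕ) (x : ℚ) : ContDiffAt ℚ (⊤ : ℕ∞) (halfBrick 0 n) x := by
  unfold halfBrick; fun_prop

/-- Smoothness of `G(t)(t+k)` at `−k` (`k ≤ n`). [cite: LaiSprangZudilin2026, §5 (proof of Lemma 5.3)] -/
theorem contDiffAt_Greg' (n : ℕ) {k : ℕ} (hk : k ≤ n) : ContDiffAt ℚ (⊤ : ℕ∞) (Greg n k) (-(k : ℚ)) := by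
  have e : Greg n k = fun t : ℚ => (n ! : ℚ) * ∏ l ∈ poles n k, (t + l)⁻¹ := by
    funext t; rw [Greg_eq n hk t]; rfl
  have hne : ∀ l ∈ poles n k, (-(k : ℚ)) + l ≠ 0 := by
    intro l hl h
    have hlk : l ≠ k := (mem_filter.1 hl).2
    have : (l : ℚ) = k := by linarith
    exact hlk (by exact_mod_cast this)
  rw [e]
  exact contDiffAt_const.mul (contDiffAt_prod fun l hl => contDiffAt_inv_add_const (hne l hl))

/-- The Taylor series of `F_k(t) := (2^{2n}(t+½)_n/n!)·(n!(t+k)/(t)_{n+1})` at `−k` (whose fourth power times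
`2t+n` is that of `R_n(t)(t+k)^4`). [cite: LaiSprangZudilin2026, §5 (R_n = (2t+n)F^4G^4)] -/
def TF (p n k : ℕ) : ℚ⟦X⟧ :=
  pTaylor p (halfBrick 0 n) (-(k : ℚ)) * pTaylor p (Greg n k) (-(k : ℚ))

/-- **`pTaylor` of `R_n(t)(t+k)^4` at `−k`** = `(C(n−2k) + 2pX) · TF^4`. [cite: LaiSprangZudilin2026, §3 (def_rik), §5] -/
theorem pTaylor_Rreg (n : ℕ) {k : ℕ} (hk : k ≤ n) :
    pTaylor p (Rreg n k) (-(k : ℚ)) = (C ((n : ℚ) - 2 * k) + C (2 * (p : ℚ)) * X) * TF p n k ^ 4 := by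
  have e : Rreg n k = fun t : ℚ =>
      (fun t : ℚ => (fun t : ℚ => 2 * t + n) t * (fun t : ℚ => halfBrick 0 n t ^ 4) t) t *
        (fun t : ℚ => Greg n k t ^ 4) t := by
    funext t; rfl
  have h1 : ContDiffAt ℚ (⊤ : ℕ∞) (fun t : ℚ => 2 * t + n) (-(k : ℚ)) := by fun_prop
  have h2 : ContDiffAt ℚ (⊤ : ℕ∞) (fun t : ℚ => halfBrick 0 n t ^ 4) (-(k : ℚ)) :=
    (contDiffAt_halfBrick' n _).pow 4
  have h3 : ContDiffAt ℚ (⊤ : ℕ∞) (fun t : ℚ => Greg n k t ^ 4) (-(k : ℚ)) :=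
    (contDiffAt_Greg' n hk).pow 4
  rw [e, pTaylor_fun_mul (h1.mul h2) h3, pTaylor_fun_mul h1 h2, pTaylor_fun_pow (contDiffAt_halfBrick' n _),
    pTaylor_fun_pow (contDiffAt_Greg' n hk), pTaylor_affine, TF]
  have : C (2 * -(k : ℚ) + n) = C ((n : ℚ) - 2 * k) := by congr 1; ring
  rw [this]; ring

/-- The coefficients of `pTaylor p (R_n(t)(t+k)^4) (−k)` are `p^j r_{n,4−j,k}` (`j ≤ 3`).
[cite: LaiSprangZudilin2026, §3 (def_rik)] -/
theorem coeff_pTaylor_Rreg (n k : ℕ) {j : ℕ} (hj : j ≤ 3) :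
    coeff j (pTaylor p (Rreg n k) (-(k : ℚ))) = (p : ℚ) ^ j * coeffR n (4 - j) k := by
  rw [coeff_pTaylor, coeffR]
  congr 3; omega

/-! ### Singular and unit factors -/

/-- The singular factors of `(t+½)_n` at `−k`: `m < n` with `p ∣ 2(m−k)+1`. [cite: LaiSprangZudilin2026, §5 (proof of Lemma 5.3: p ∣ 2ℓ−1)] -/
def singN (p n k : ℕ) : Finset ℕ := (range n).filter (fun m => (2 * m + 1) % p = (2 * k) % p)

/-- The unit factors of `(t+½)_n` at `−k`. [cite: LaiSprangZudilin2026, §5] -/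
def unitN (p n k : ℕ) : Finset ℕ := (range n).filter (fun m => ¬ (2 * m + 1) % p = (2 * k) % p)

/-- The singular inverse factors of `G(t)(t+k)` at `−k`: `l ≠ k`, `l ≤ n`, `p ∣ l − k`. [cite: LaiSprangZudilin2026, §5] -/
def singD (p n k : ℕ) : Finset ℕ := (poles n k).filter (fun l => l % p = k % p)

/-- The unit inverse factors of `G(t)(t+k)` at `−k`. [cite: LaiSprangZudilin2026, §5] -/
def unitD (p n k : ℕ) : Finset ℕ := (poles n k).filter (fun l => ¬ l % p = k % p)

/-- The UNIT PART `𝒰 = ∏_{unit m} (C(m−k+½) + pX) · ∏_{unit l} invLin p (l−k)`. [cite: LaiSprangZudilin2026, §5] -/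
def Upart (p n k : ℕ) : ℚ⟦X⟧ :=
  (∏ m ∈ unitN p n k, (C (wN k m) + C (p : ℚ) * X)) * ∏ l ∈ unitD p n k, invLin p (wD k l)

/-- The constant coefficient of the unit part: `u = ∏_{unit m}(m−k+½) · ∏_{unit l}(l−k)⁻¹`. [cite: LaiSprangZudilin2026, §5] -/
def uval (p n k : ℕ) : ℚ :=
  (∏ m ∈ unitN p n k, wN k m) * ∏ l ∈ unitD p n k, (wD k l)⁻¹

/-- The SINGULAR PART with the `p`'s extracted: `ℳ = ∏_{sing m} (C((m−k+½)/p) + X) · ∏_{sing l} invLin 1 ((l−k)/p)`.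
[cite: LaiSprangZudilin2026, §5] -/
def Mpart (p n k : ℕ) : ℚ⟦X⟧ :=
  (∏ m ∈ singN p n k, (C (wN k m / p) + X)) * ∏ l ∈ singD p n k, invLin 1 (wD k l / p)

/-- The constant coefficient of the singular part. [cite: LaiSprangZudilin2026, §5] -/
def mval (p n k : ℕ) : ℚ :=
  (∏ m ∈ singN p n k, wN k m / p) * ∏ l ∈ singD p n k, (wD k l / p)⁻¹

/-- **Extraction of the `p`'s**: `TF = C(2^{2n}) · C(p^{s₁}·p^{−s₂}) · 𝒰 · ℳ`, `s₁ = #singN`, `s₂ = #singD`.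
[cite: LaiSprangZudilin2026, §5 (proof of Lemma 5.3)] -/
theorem TF_eq [hp : Fact p.Prime] (n : ℕ) {k : ℕ} (hk : k ≤ n) :
    TF p n k = C ((2 : ℚ) ^ (2 * n)) * C ((p : ℚ) ^ (singN p n k).card * ((p : ℚ)⁻¹) ^ (singD p n k).card) *
      Upart p n k * Mpart p n k := by
  have hp0 : (p : ℚ) ≠ 0 := by exact_mod_cast hp.out.ne_zero
  have hfac : (n ! : ℚ) ≠ 0 := by exact_mod_cast Nat.factorial_ne_zero n
  rw [TF, pTaylor_halfBrick, pTaylor_Greg n hk]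
  -- split the products into unit and singular factors
  have hN : (∏ m ∈ singN p n k, (C (wN k m) + C (p : ℚ) * X)) * ∏ m ∈ unitN p n k, (C (wN k m) + C (p : ℚ) * X)
      = ∏ m ∈ range n, (C (wN k m) + C (p : ℚ) * X) :=
    prod_filter_mul_prod_filter_not (range n) _ _
  have hD : (∏ l ∈ singD p n k, invLin p (wD k l)) * ∏ l ∈ unitD p n k, invLin p (wD k l)
      = ∏ l ∈ poles n k, invLin p (wD k l) :=
    prod_filter_mul_prod_filter_not (poles n k) _ _
  rw [← hN, ← hD]
  -- rewrite the singular factors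
  have hN' : ∏ m ∈ singN p n k, (C (wN k m) + C (p : ℚ) * X) =
      C ((p : ℚ) ^ (singN p n k).card) * ∏ m ∈ singN p n k, (C (wN k m / p) + X) := by
    rw [map_pow, ← prod_const, ← prod_mul_distrib]
    refine prod_congr rfl fun m _ => ?_
    have : C (wN k m) = C (p : ℚ) * C (wN k m / p) := by rw [← map_mul]; congr 1; field_simp
    rw [this]; ring
  have hD' : ∏ l ∈ singD p n k, invLin p (wD k l) =
      C (((p : ℚ)⁻¹) ^ (singD p n k).card) * ∏ l ∈ singD p n k, invLin 1 (wD k l / p) := by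
    rw [map_pow, ← prod_const, ← prod_mul_distrib]
    refine prod_congr rfl fun l _ => ?_
    have : invLin (p : ℚ) (wD k l) = invLin p ((p : ℚ) * (wD k l / p)) := by
      congr 1; field_simp
    rw [this, invLin_scale hp0]
  rw [hN', hD', Upart, Mpart, map_mul]
  have hc : C ((2 : ℚ) ^ (2 * n) / (n ! : ℚ)) * C (n ! : ℚ) = C ((2 : ℚ) ^ (2 * n)) := by
    rw [← map_mul]; congr 1; field_simp
  rw [← hc]; ring

end Lemma53

end Literature.NumberTheory.Irrationality.LaiSprangZudilin2026


namespace Literature.NumberTheory.Irrationality.LaiSprangZudilin2026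

open Finset Filter PowerSeries Literature.Analysis.Calculus Literature.NumberTheory.Transcendental
open Literature.NumberTheory.Irrationality.RivoalZudilin2020 (halfBrick Greg Greg_eq)
open scoped Nat

namespace Lemma53

variable {p : ℕ}

/-! ### `p`-adic orders of the factor values -/

/-- An odd prime does not divide `2`. [cite: LaiSprangZudilin2026, §5 (proof of Lemma 5.3)] -/
theorem not_dvd_two [hp : Fact p.Prime] (hp2 : p ≠ 2) : ¬ p ∣ 2 := fun h =>
  hp2 ((Nat.prime_dvd_prime_iff_eq hp.out Nat.prime_two).1 h)

/-- `ord_p (1/2) = 0` for an odd prime `p`. [cite: LaiSprangZudilin2026, §5 (proof of Lemma 5.3)] -/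
theorem padicOrdGe_half [hp : Fact p.Prime] (hp2 : p ≠ 2) : PadicOrdGe p 0 ((2 : ℚ)⁻¹) := by
  refine PadicOrdGe.of_eq (le_of_eq ?_)
  rw [padicValRat.inv, show (2 : ℚ) = ((2 : ℕ) : ℚ) by norm_num, padicValRat.of_nat]
  simp [padicValNat.eq_zero_of_not_dvd (not_dvd_two hp2)]

/-- `m − k + ½ = (2(m−k)+1)/2` is `p`-integral (`p` odd). [cite: LaiSprangZudilin2026, §5 (proof of Lemma 5.3)] -/
theorem padicOrdGe_wN [hp : Fact p.Prime] (hp2 : p ≠ 2) (k m : ℕ) : PadicOrdGe p 0 (wN k m) := by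
  have e : wN k m = ((2 * ((m : ℤ) - k) + 1 : ℤ) : ℚ) * (2 : ℚ)⁻¹ := by
    rw [wN]; push_cast; ring
  rw [e]
  exact ((PadicOrdGe.of_int (p := p) _).mul (padicOrdGe_half hp2)).mono (by norm_num)

/-- Membership in `singN`: `p ∣ 2(m−k)+1` (in `ℤ`) and `m < n`. [cite: LaiSprangZudilin2026, §5 (proof of Lemma 5.3)] -/
theorem dvd_of_mem_singN {n k m : ℕ} (hm : m ∈ singN p n k) :
    m < n ∧ (p : ℤ) ∣ 2 * ((m : ℤ) - k) + 1 := by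
  have hm' := mem_filter.1 hm
  refine ⟨mem_range.1 hm'.1, ?_⟩
  have h := Nat.modEq_iff_dvd.1 (hm'.2 : 2 * m + 1 ≡ 2 * k [MOD p])
  push_cast at h
  have e : (2 * (k : ℤ)) - (2 * m + 1) = -(2 * ((m : ℤ) - k) + 1) := by ring
  rwa [e, dvd_neg] at h

/-- Membership in `singD`: `l ≤ n`, `l ≠ k`, `p ∣ l − k` (in `ℤ`). [cite: LaiSprangZudilin2026, §5 (proof of Lemma 5.3)] -/
theorem dvd_of_mem_singD {n k l : ℕ} (hl : l ∈ singD p n k) :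
    l ≤ n ∧ l ≠ k ∧ (p : ℤ) ∣ (l : ℤ) - k := by
  have hl' := mem_filter.1 hl
  have hpol := mem_filter.1 hl'.1
  refine ⟨Nat.lt_succ_iff.1 (mem_range.1 hpol.1), hpol.2, ?_⟩
  have h := Nat.modEq_iff_dvd.1 ((hl'.2 : l % p = k % p).symm)
  simpa using h

/-- Membership in `unitD`: `l ≤ n`, `l ≠ k`, `p ∤ l − k`. [cite: LaiSprangZudilin2026, §5 (proof of Lemma 5.3)] -/
theorem not_dvd_of_mem_unitD {n k l : ℕ} (hl : l ∈ unitD p n k) :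
    l ≤ n ∧ l ≠ k ∧ ¬ (p : ℤ) ∣ (l : ℤ) - k := by
  have hl' := mem_filter.1 hl
  have hpol := mem_filter.1 hl'.1
  refine ⟨Nat.lt_succ_iff.1 (mem_range.1 hpol.1), hpol.2, fun h => hl'.2 ?_⟩
  have h' : (p : ℤ) ∣ (k : ℤ) - l := by
    have := dvd_neg.2 h; rwa [neg_sub] at this
  exact Nat.modEq_iff_dvd.2 h'

/-- For a singular factor: `(m−k+½)/p = c/2` with `2(m−k)+1 = pc`, and `p ∤ c` because `|2(m−k)+1| ≤ 2n−1 < p²`;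
so `(m−k+½)/p` is a `p`-adic unit. [cite: LaiSprangZudilin2026, §5 (proof of Lemma 5.3: v_p(2ℓ−1) ≤ 1)] -/
theorem padicOrdGe_wN_div [hp : Fact p.Prime] (hp2 : p ≠ 2) {n k m : ℕ} (hm : m ∈ singN p n k)
    (hk : k ≤ n) (hn : 2 * n < p ^ 2) :
    PadicOrdGe p 0 (wN k m / p) ∧ PadicOrdGe p 0 (wN k m / p)⁻¹ ∧ wN k m / p ≠ 0 := by
  obtain ⟨hmn, c, hc⟩ := dvd_of_mem_singN hm
  have hp0 : (p : ℚ) ≠ 0 := by exact_mod_cast hp.out.ne_zero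
  have hpsq : ((p : ℤ)) ^ 2 = ((p ^ 2 : ℕ) : ℤ) := by push_cast; ring
  have e : wN k m / p = (c : ℚ) * (2 : ℚ)⁻¹ := by
    have : wN k m = ((2 * ((m : ℤ) - k) + 1 : ℤ) : ℚ) / 2 := by rw [wN]; push_cast; ring
    rw [this, hc]; push_cast; field_simp
  have hc0 : c ≠ 0 := by
    rintro rfl
    have : 2 * ((m : ℤ) - k) + 1 = 0 := by rw [hc]; ring
    omega
  -- `|c| < p`, hence `p ∤ c`
  have hcnd : ¬ (p : ℤ) ∣ c := by
    rintro ⟨d, hd⟩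
    have hd0 : d ≠ 0 := by rintro rfl; simp at hd; exact hc0 hd
    have h1 : (1 : ℤ) ≤ |d| := Int.one_le_abs hd0
    have hlt : |2 * ((m : ℤ) - k) + 1| < (p : ℤ) ^ 2 := by
      have h2n : ((2 * n : ℕ) : ℤ) < ((p ^ 2 : ℕ) : ℤ) := by exact_mod_cast hn
      push_cast at h2n
      rw [abs_lt]; constructor <;> linarith
    rw [hc, hd, ← mul_assoc, abs_mul, abs_mul, abs_of_nonneg (by positivity : (0 : ℤ) ≤ p)] at hlt
    have hpp : (p : ℤ) * p * 1 ≤ (p : ℤ) * p * |d| := by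
      have : (0 : ℤ) ≤ (p : ℤ) * p := by positivity
      nlinarith
    nlinarith
  rw [e]
  refine ⟨by simpa using (PadicOrdGe.of_int (p := p) c).mul (padicOrdGe_half hp2), ?_, ?_⟩
  · rw [mul_inv, inv_inv]
    have h1 : PadicOrdGe p 0 ((c : ℚ)⁻¹) := by
      have := PadicOrdGe.inv_of_int (p := p) (c := c) (m := 0)
        (by rw [padicValInt.eq_zero_of_not_dvd hcnd])
      simpa using this
    simpa using h1.mul (PadicOrdGe.of_nat (p := p) 2)
  · exact mul_ne_zero (by exact_mod_cast hc0) (by norm_num)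

/-- For a unit inverse factor (`l ≢ k (mod p)`): `(l−k)⁻¹` is `p`-integral. [cite: Zudilin2004, §7 Lemma 18 (proof)] -/
theorem padicOrdGe_wD_inv [hp : Fact p.Prime] {n k l : ℕ} (hl : l ∈ unitD p n k) :
    PadicOrdGe p 0 (wD k l)⁻¹ := by
  obtain ⟨-, -, hnd⟩ := not_dvd_of_mem_unitD hl
  have e : wD k l = (((l : ℤ) - k : ℤ) : ℚ) := by rw [wD]; push_cast; ring
  rw [e]
  have := PadicOrdGe.inv_of_int (p := p) (c := (l : ℤ) - k) (m := 0)
    (by rw [padicValInt.eq_zero_of_not_dvd hnd])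
  simpa using this

/-- For a singular inverse factor (`l ≡ k (mod p)`, `0 < |l−k| ≤ n < p²`): `β = (l−k)/p` and `β⁻¹` are
`p`-integral (`ord_p (l−k) = 1`). [cite: Zudilin2004, §7 Lemma 18 (proof: p² > b₀−a₀−1)] -/
theorem padicOrdGe_wD_div [hp : Fact p.Prime] {n k l : ℕ} (hl : l ∈ singD p n k) (hk : k ≤ n) (hn : n < p ^ 2) :
    PadicOrdGe p 0 (wD k l / p) ∧ PadicOrdGe p 0 (wD k l / p)⁻¹ ∧ wD k l / p ≠ 0 := by
  obtain ⟨hln, hlk, hdvd⟩ := dvd_of_mem_singD hl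
  set z : ℤ := (l : ℤ) - k with hz
  have hz0 : z ≠ 0 := sub_ne_zero.2 (by exact_mod_cast hlk)
  have hv1 : padicValInt p z ≤ 1 := by
    refine padicValInt_le_one_of_abs_lt_sq p hz0 ?_
    have : |z| ≤ n := by rw [hz, abs_le]; constructor <;> omega
    have h4 : ((n : ℕ) : ℤ) < ((p ^ 2 : ℕ) : ℤ) := by exact_mod_cast hn
    push_cast at h4; linarith
  have hv1' : (1 : ℕ) ≤ padicValInt p z :=
    ((padicValInt_dvd_iff 1 z).1 (by simpa using hdvd)).resolve_left hz0
  have hv : padicValInt p z = 1 := le_antisymm hv1 hv1'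
  have e : wD k l = (z : ℚ) := by rw [wD, hz]; push_cast; ring
  have hp0 : (p : ℚ) ≠ 0 := by exact_mod_cast hp.out.ne_zero
  have hzq : (z : ℚ) ≠ 0 := by exact_mod_cast hz0
  have hvz : padicValRat p (z : ℚ) = 1 := by rw [padicValRat.of_int, hv]; rfl
  have hvp : padicValRat p (p : ℚ) = 1 := padicValRat.self hp.out.one_lt
  rw [e]
  refine ⟨PadicOrdGe.of_eq (le_of_eq ?_), PadicOrdGe.of_eq (le_of_eq ?_), div_ne_zero hzq hp0⟩
  · rw [padicValRat.div hzq hp0, hvz, hvp]; norm_num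
  · rw [inv_div, padicValRat.div hp0 hzq, hvz, hvp]; norm_num

/-! ### The unit part is `p`-integral and congruent to its constant coefficient; the singular part -/

/-- `𝒰` is `p`-integral and `𝒰 ≡ C(u) (mod p)`. [cite: LaiSprangZudilin2026, §5 (proof of Lemma 5.3)] -/
theorem Upart_psOrdGe [hp : Fact p.Prime] (hp2 : p ≠ 2) (n k : ℕ) :
    PSOrdGe p 0 (Upart p n k) ∧ PSOrdGe p 1 (Upart p n k - C (uval p n k)) := by
  have hN0 : ∀ m ∈ unitN p n k, PSOrdGe p 0 (C (wN k m) + C (p : ℚ) * X) :=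
    fun m _ => (psOrdGe_lin (padicOrdGe_wN hp2 k m)).1
  have hN1 : ∀ m ∈ unitN p n k, PSOrdGe p 1 (C (wN k m) + C (p : ℚ) * X - C (wN k m)) :=
    fun m _ => (psOrdGe_lin (padicOrdGe_wN hp2 k m)).2
  have hNc : ∀ m ∈ unitN p n k, PSOrdGe p 0 (C (wN k m)) :=
    fun m _ => PSOrdGe.C (padicOrdGe_wN hp2 k m)
  have hD0 : ∀ l ∈ unitD p n k, PSOrdGe p 0 (invLin p (wD k l)) :=
    fun l hl => (psOrdGe_invLin_p (padicOrdGe_wD_inv hl)).1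
  have hD1 : ∀ l ∈ unitD p n k, PSOrdGe p 1 (invLin p (wD k l) - C (wD k l)⁻¹) :=
    fun l hl => (psOrdGe_invLin_p (padicOrdGe_wD_inv hl)).2
  have hDc : ∀ l ∈ unitD p n k, PSOrdGe p 0 (C (wD k l)⁻¹) :=
    fun l hl => PSOrdGe.C (padicOrdGe_wD_inv hl)
  have hA := PSOrdGe.prod_congr (unitN p n k) hN0 hNc hN1
  have hB := PSOrdGe.prod_congr (unitD p n k) hD0 hDc hD1
  have hDint : PSOrdGe p 0 (C (∏ l ∈ unitD p n k, (wD k l)⁻¹)) :=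
    PSOrdGe.C (by simpa using PadicOrdGe.prod (p := p) (v := fun _ => (0 : ℤ)) fun l hl => padicOrdGe_wD_inv hl)
  rw [← map_prod] at hA hB
  refine ⟨by rw [Upart]; exact ((PSOrdGe.prod _ hN0).mul (PSOrdGe.prod _ hD0)).mono (by norm_num), ?_⟩
  rw [Upart, uval, map_mul]
  exact PSOrdGe.mul_congr (PSOrdGe.prod _ hN0) hDint hA hB

/-- `u` is `p`-integral. [cite: LaiSprangZudilin2026, §5] -/
theorem padicOrdGe_uval [hp : Fact p.Prime] (hp2 : p ≠ 2) (n k : ℕ) : PadicOrdGe p 0 (uval p n k) := by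
  rw [uval]
  have h1 := PadicOrdGe.prod (p := p) (s := unitN p n k) (v := fun _ => (0 : ℤ)) (f := fun m => wN k m)
    fun m _ => padicOrdGe_wN hp2 k m
  have h2 := PadicOrdGe.prod (p := p) (s := unitD p n k) (v := fun _ => (0 : ℤ)) (f := fun l => (wD k l)⁻¹)
    fun l hl => padicOrdGe_wD_inv hl
  simpa using h1.mul h2

/-- `ℳ` is `p`-integral (`k ≤ n`, `2n < p²`). [cite: LaiSprangZudilin2026, §5 (proof of Lemma 5.3)] -/
theorem Mpart_psOrdGe [hp : Fact p.Prime] (hp2 : p ≠ 2) {n k : ℕ} (hk : k ≤ n) (hn : 2 * n < p ^ 2) :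
    PSOrdGe p 0 (Mpart p n k) := by
  have hn' : n < p ^ 2 := by omega
  refine ((PSOrdGe.prod (singN p n k) fun m hm => ?_).mul
    (PSOrdGe.prod (singD p n k) fun l hl => ?_)).mono (by norm_num)
  · exact (PSOrdGe.C (padicOrdGe_wN_div hp2 hm hk hn).1).add (PSOrdGe.X p)
  · exact psOrdGe_invLin_one (padicOrdGe_wD_div hl hk hn').2.1

/-- The constant coefficient of `ℳ` is `mval`. [cite: LaiSprangZudilin2026, §5 (proof of Lemma 5.3)] -/
theorem constantCoeff_Mpart (p n k : ℕ) : constantCoeff (Mpart p n k) = mval p n k := by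
  rw [Mpart, mval, map_mul, map_prod, map_prod]
  congr 1
  · refine prod_congr rfl fun m _ => ?_
    rw [map_add, constantCoeff_C, constantCoeff_X, add_zero]
  · refine prod_congr rfl fun l _ => ?_
    rw [constantCoeff_invLin]

/-- The constant coefficient of `𝒰` is `uval`. [cite: LaiSprangZudilin2026, §5 (proof of Lemma 5.3)] -/
theorem constantCoeff_Upart (p n k : ℕ) : constantCoeff (Upart p n k) = uval p n k := by
  rw [Upart, uval, map_mul, map_prod, map_prod]
  congr 1
  · refine prod_congr rfl fun m _ => ?_
    rw [map_add, constantCoeff_C, map_mul, constantCoeff_C, constantCoeff_X, mul_zero, add_zero]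
  · refine prod_congr rfl fun l _ => ?_
    rw [constantCoeff_invLin]

/-- `mval` is a `p`-adic unit (and non-zero). [cite: LaiSprangZudilin2026, §5] -/
theorem padicOrdGe_mval [hp : Fact p.Prime] (hp2 : p ≠ 2) {n k : ℕ} (hk : k ≤ n) (hn : 2 * n < p ^ 2) :
    PadicOrdGe p 0 (mval p n k) ∧ PadicOrdGe p 0 (mval p n k)⁻¹ ∧ mval p n k ≠ 0 := by
  have hn' : n < p ^ 2 := by omega
  have hA : ∀ m ∈ singN p n k, PadicOrdGe p 0 (wN k m / p) ∧ PadicOrdGe p 0 (wN k m / p)⁻¹ ∧ wN k m / p ≠ 0 :=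
    fun m hm => padicOrdGe_wN_div hp2 hm hk hn
  have hB : ∀ l ∈ singD p n k, PadicOrdGe p 0 (wD k l / p) ∧ PadicOrdGe p 0 (wD k l / p)⁻¹ ∧ wD k l / p ≠ 0 :=
    fun l hl => padicOrdGe_wD_div hl hk hn'
  refine ⟨?_, ?_, ?_⟩
  · rw [mval]
    have h1 := PadicOrdGe.prod (p := p) (s := singN p n k) (v := fun _ => (0 : ℤ)) (f := fun m => wN k m / p)
      fun m hm => (hA m hm).1
    have h2 := PadicOrdGe.prod (p := p) (s := singD p n k) (v := fun _ => (0 : ℤ))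
      (f := fun l => (wD k l / p)⁻¹) fun l hl => (hB l hl).2.1
    simpa using h1.mul h2
  · rw [mval, mul_inv, ← prod_inv_distrib, ← prod_inv_distrib]
    have h1 := PadicOrdGe.prod (p := p) (s := singN p n k) (v := fun _ => (0 : ℤ))
      (f := fun m => (wN k m / p)⁻¹) fun m hm => (hA m hm).2.1
    have h2 := PadicOrdGe.prod (p := p) (s := singD p n k) (v := fun _ => (0 : ℤ))
      (f := fun l => (wD k l / p)⁻¹⁻¹) fun l hl => by simpa using (hB l hl).1
    simpa using h1.mul h2
  · rw [mval]
    exact mul_ne_zero (prod_ne_zero_iff.2 fun m hm => (hA m hm).2.2)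
      (prod_ne_zero_iff.2 fun l hl => inv_ne_zero (hB l hl).2.2)

end Lemma53

end Literature.NumberTheory.Irrationality.LaiSprangZudilin2026


namespace Literature.NumberTheory.Irrationality.LaiSprangZudilin2026

open Finset Filter PowerSeries Literature.Analysis.Calculus Literature.NumberTheory.Transcendental
open Literature.NumberTheory.Irrationality.RivoalZudilin2020 (halfBrick Greg Greg_eq)
open scoped Nat

namespace Lemma53

variable {p : ℕ}

/-! ### Base-`p` digits: `p = 2h + 1` -/

/-- For an odd prime, `p = 2(p/2) + 1`. [cite: LaiSprangZudilin2026, §5 (proof of Lemma 5.3)] -/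
theorem two_mul_half_add_one [hp : Fact p.Prime] (hp2 : p ≠ 2) : 2 * (p / 2) + 1 = p :=
  Nat.two_mul_div_two_add_one_of_odd ((hp.out.eq_two_or_odd').resolve_left hp2)

/-- `(N + h)/p = N/p + [N mod p > h]` (`p = 2h+1`). [cite: LaiSprangZudilin2026, §5 (proof of Lemma 5.3)] -/
theorem add_half_div [hp : Fact p.Prime] (hp2 : p ≠ 2) (N : ℕ) :
    (N + p / 2) / p = N / p + (if N % p ≤ p / 2 then 0 else 1) := by
  have hp0 : 0 < p := hp.out.pos
  have hodd := two_mul_half_add_one hp2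
  set h := p / 2 with hh
  have e : N + h = p * (N / p) + (N % p + h) := by
    have := Nat.div_add_mod N p; omega
  rw [e, Nat.mul_add_div hp0]
  congr 1
  have hr : N % p < p := Nat.mod_lt _ hp0
  split_ifs with hle
  · exact Nat.div_eq_of_lt (by omega)
  · exact Nat.div_eq_of_lt_le (by omega) (by omega)

/-- No borrow: if the last digits of `k` and `n − k` are both `≤ h` (`k ≤ n`), then the last digit of `k` is at most
that of `n`, and `(n−k)/p = n/p − k/p`, `(n−k) mod p = n mod p − k mod p`. [cite: LaiSprangZudilin2026, §5 (proof of Lemma 5.3)] -/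
theorem digits_of_good [hp : Fact p.Prime] (hp2 : p ≠ 2) {n k : ℕ} (hk : k ≤ n) (h1 : k % p ≤ p / 2)
    (h2 : (n - k) % p ≤ p / 2) :
    k % p ≤ n % p ∧ (n - k) / p = n / p - k / p ∧ (n - k) % p = n % p - k % p := by
  have hp0 : 0 < p := hp.out.pos
  have hodd := two_mul_half_add_one hp2
  have hlt : (n - k) % p + k % p < p := by omega
  -- the units digits add without carry
  have hmod : n % p = (n - k) % p + k % p := by
    conv_lhs => rw [show n = (n - k) + k by omega, Nat.add_mod, Nat.mod_eq_of_lt hlt]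
  -- hence the quotients add
  have hdiv : n / p = (n - k) / p + k / p := by
    have e : n = p * ((n - k) / p + k / p) + ((n - k) % p + k % p) := by
      have e1 := Nat.div_add_mod (n - k) p
      have e2 := Nat.div_add_mod k p
      have e3 : p * ((n - k) / p + k / p) = p * ((n - k) / p) + p * (k / p) := by ring
      omega
    conv_lhs => rw [e, Nat.mul_add_div hp0, Nat.div_eq_of_lt hlt]
    rfl
  refine ⟨hmod ▸ Nat.le_add_left _ _, ?_, ?_⟩
  · rw [hdiv, Nat.add_sub_cancel]
  · rw [hmod, Nat.add_sub_cancel]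

/-! ### The singular sets explicitly -/

/-- `singD = {k − (j+1)p : j < k/p} ∪ {k + (j+1)p : j < (n−k)/p}`. [cite: LaiSprangZudilin2026, §5 (proof of Lemma 5.3)] -/
theorem singD_eq [hp : Fact p.Prime] {n k : ℕ} (hk : k ≤ n) :
    singD p n k = (range (k / p)).image (fun j => k - (j + 1) * p) ∪
      (range ((n - k) / p)).image (fun j => k + (j + 1) * p) := by
  have hp0 : 0 < p := hp.out.pos
  ext l
  simp only [singD, poles, mem_filter, mem_range, mem_union, mem_image]
  constructor
  · rintro ⟨⟨hln, hlk⟩, hmod⟩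
    have el := Nat.div_add_mod l p
    have ek := Nat.div_add_mod k p
    have hr : l % p < p := Nat.mod_lt _ hp0
    generalize hq1 : l / p = q₁ at el
    generalize hq2 : k / p = q₂ at ek
    rw [hmod] at el
    rcases lt_or_gt_of_ne hlk with hlt | hgt
    · left
      have hq : q₁ < q₂ := by
        by_contra hc
        have := Nat.mul_le_mul_left p (not_lt.1 hc)
        omega
      refine ⟨q₂ - q₁ - 1, by omega, ?_⟩
      have e1 : (q₂ - q₁ - 1 + 1) * p = p * q₂ - p * q₁ := by
        rw [show q₂ - q₁ - 1 + 1 = q₂ - q₁ by omega, Nat.sub_mul, mul_comm q₂, mul_comm q₁]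
      have := Nat.mul_le_mul_left p hq.le
      omega
    · right
      have hq : q₂ < q₁ := by
        by_contra hc
        have := Nat.mul_le_mul_left p (not_lt.1 hc)
        omega
      have e1 : (q₁ - q₂ - 1 + 1) * p = p * q₁ - p * q₂ := by
        rw [show q₁ - q₂ - 1 + 1 = q₁ - q₂ by omega, Nat.sub_mul, mul_comm q₁, mul_comm q₂]
      have := Nat.mul_le_mul_left p hq.le
      refine ⟨q₁ - q₂ - 1, ?_, by omega⟩
      rw [Nat.lt_iff_add_one_le, Nat.le_div_iff_mul_le hp0]
      omega
  · rintro (⟨j, hj, rfl⟩ | ⟨j, hj, rfl⟩)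
    · have hjp : (j + 1) * p ≤ k := (Nat.le_div_iff_mul_le hp0).1 (by omega)
      have hpos : p ≤ (j + 1) * p := Nat.le_mul_of_pos_left p (by omega)
      refine ⟨⟨by omega, by omega⟩, ?_⟩
      rw [mul_comm] at hjp ⊢
      exact Nat.sub_mul_mod hjp
    · have hjp : (j + 1) * p ≤ n - k := (Nat.le_div_iff_mul_le hp0).1 (by omega)
      have hpos : p ≤ (j + 1) * p := Nat.le_mul_of_pos_left p (by omega)
      refine ⟨⟨by omega, by omega⟩, ?_⟩
      exact Nat.add_mul_mod_self_right _ _ _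

/-- `singN = {k + h − (j+1)p : j < (k+h)/p} ∪ {k + h + jp : j < (n−k+h)/p}` (`h = p/2`): the `m < n` with
`2m + 1 ≡ 2k (mod p)`, i.e. `m ≡ k + h`. [cite: LaiSprangZudilin2026, §5 (proof of Lemma 5.3: p ∣ 2ℓ − 1)] -/
theorem singN_eq [hp : Fact p.Prime] (hp2 : p ≠ 2) {n k : ℕ} (hk : k ≤ n) :
    singN p n k = (range ((k + p / 2) / p)).image (fun j => k + p / 2 - (j + 1) * p) ∪
      (range ((n - k + p / 2) / p)).image (fun j => k + p / 2 + j * p) := by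
  have hp0 : 0 < p := hp.out.pos
  have hodd := two_mul_half_add_one hp2
  have hpodd : Odd p := (hp.out.eq_two_or_odd').resolve_left hp2
  set h := p / 2 with hh
  ext m
  simp only [singN, mem_filter, mem_range, mem_union, mem_image]
  constructor
  · rintro ⟨hmn, hmod⟩
    have ea := Nat.div_add_mod (2 * m + 1) p
    have eb := Nat.div_add_mod (2 * k) p
    rcases lt_or_ge m k with hlt | hge
    · left
      -- `2k − (2m+1) = p·t` with `t` odd
      set t := (2 * k) / p - (2 * m + 1) / p with ht
      have hq : (2 * m + 1) / p ≤ (2 * k) / p := by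
        by_contra hc; push Not at hc
        have := Nat.mul_le_mul_left p hc.le
        omega
      have hpt : p * t = 2 * k - (2 * m + 1) := by
        rw [ht, Nat.mul_sub]
        have := Nat.mul_le_mul_left p hq
        omega
      have htodd : Odd t := by
        have : Odd (p * t) := by rw [Nat.odd_iff]; omega
        exact (Nat.odd_mul.1 this).2
      obtain ⟨j, hj⟩ := htodd
      have e1 : p * t = 2 * (j * p) + p := by rw [hj]; ring
      refine ⟨j, ?_, ?_⟩
      · rw [Nat.lt_iff_add_one_le, Nat.le_div_iff_mul_le hp0]
        have : (j + 1) * p = j * p + p := by ring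
        omega
      · have : (j + 1) * p = j * p + p := by ring
        omega
    · right
      set t := (2 * m + 1) / p - (2 * k) / p with ht
      have hq : (2 * k) / p ≤ (2 * m + 1) / p := by
        by_contra hc; push Not at hc
        have := Nat.mul_le_mul_left p hc.le
        omega
      have hpt : p * t = (2 * m + 1) - 2 * k := by
        rw [ht, Nat.mul_sub]
        have := Nat.mul_le_mul_left p hq
        omega
      have htodd : Odd t := by
        have : Odd (p * t) := by rw [Nat.odd_iff]; omega
        exact (Nat.odd_mul.1 this).2
      obtain ⟨j, hj⟩ := htodd
      have e1 : p * t = 2 * (j * p) + p := by rw [hj]; ring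
      refine ⟨j, ?_, ?_⟩
      · rw [Nat.lt_iff_add_one_le, Nat.le_div_iff_mul_le hp0]
        have : (j + 1) * p = j * p + p := by ring
        omega
      · omega
  · rintro (⟨j, hj, rfl⟩ | ⟨j, hj, rfl⟩)
    · have hjp : (j + 1) * p ≤ k + h := (Nat.le_div_iff_mul_le hp0).1 (by omega)
      have e1 : (j + 1) * p = j * p + p := by ring
      refine ⟨by omega, ?_⟩
      -- `2m + 1 = 2k − (2j+1)p`
      have e2 : 2 * (k + h - (j + 1) * p) + 1 = 2 * k - (2 * j + 1) * p := by
        have : (2 * j + 1) * p = 2 * (j * p) + p := by ring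
        omega
      have hle : p * (2 * j + 1) ≤ 2 * k := by
        have : (2 * j + 1) * p = 2 * (j * p) + p := by ring
        rw [mul_comm]; omega
      rw [e2, mul_comm (2 * j + 1)]
      exact Nat.sub_mul_mod hle
    · have hjp : (j + 1) * p ≤ n - k + h := (Nat.le_div_iff_mul_le hp0).1 (by omega)
      have e1 : (j + 1) * p = j * p + p := by ring
      refine ⟨by omega, ?_⟩
      have e2 : 2 * (k + h + j * p) + 1 = 2 * k + (2 * j + 1) * p := by
        have : (2 * j + 1) * p = 2 * (j * p) + p := by ring
        omega
      rw [e2]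
      exact Nat.add_mul_mod_self_right _ _ _

/-- `#singD = k/p + (n−k)/p`. [cite: LaiSprangZudilin2026, §5] -/
theorem card_singD [hp : Fact p.Prime] {n k : ℕ} (hk : k ≤ n) :
    (singD p n k).card = k / p + (n - k) / p := by
  have hp0 : 0 < p := hp.out.pos
  rw [singD_eq hk, card_union_of_disjoint, card_image_of_injOn, card_image_of_injOn, card_range, card_range]
  · intro a _ b _ hab
    have h : (a + 1) * p = (b + 1) * p := by simp only at hab; omega
    have := Nat.eq_of_mul_eq_mul_right hp0 h
    omega
  · intro a ha b hb hab
    have ha' : (a + 1) * p ≤ k := (Nat.le_div_iff_mul_le hp0).1 (by simpa [mem_range] using ha)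
    have hb' : (b + 1) * p ≤ k := (Nat.le_div_iff_mul_le hp0).1 (by simpa [mem_range] using hb)
    have h : (a + 1) * p = (b + 1) * p := by
      simp only at hab
      generalize (a + 1) * p = P at hab ha'
      generalize (b + 1) * p = Q at hab hb'
      omega
    have := Nat.eq_of_mul_eq_mul_right hp0 h
    omega
  · rw [disjoint_left]
    rintro x hx1 hx2
    obtain ⟨a, ha, rfl⟩ := mem_image.1 hx1
    obtain ⟨b, _, hab⟩ := mem_image.1 hx2
    have ha' : (a + 1) * p ≤ k := (Nat.le_div_iff_mul_le hp0).1 (by simpa [mem_range] using ha)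
    have hpos : p ≤ (a + 1) * p := Nat.le_mul_of_pos_left p (by omega)
    generalize (a + 1) * p = P at hab ha' hpos
    generalize (b + 1) * p = Q at hab
    omega

/-- `#singN = (k+h)/p + (n−k+h)/p`. [cite: LaiSprangZudilin2026, §5] -/
theorem card_singN [hp : Fact p.Prime] (hp2 : p ≠ 2) {n k : ℕ} (hk : k ≤ n) :
    (singN p n k).card = (k + p / 2) / p + (n - k + p / 2) / p := by
  have hp0 : 0 < p := hp.out.pos
  have hodd := two_mul_half_add_one hp2
  rw [singN_eq hp2 hk, card_union_of_disjoint, card_image_of_injOn, card_image_of_injOn, card_range, card_range]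
  · intro a _ b _ hab
    have h : a * p = b * p := by simp only at hab; omega
    exact Nat.eq_of_mul_eq_mul_right hp0 h
  · intro a ha b hb hab
    have ha' : (a + 1) * p ≤ k + p / 2 := (Nat.le_div_iff_mul_le hp0).1 (by simpa [mem_range] using ha)
    have hb' : (b + 1) * p ≤ k + p / 2 := (Nat.le_div_iff_mul_le hp0).1 (by simpa [mem_range] using hb)
    have h : (a + 1) * p = (b + 1) * p := by
      simp only at hab
      generalize (a + 1) * p = P at hab ha'
      generalize (b + 1) * p = Q at hab hb'
      omega
    have := Nat.eq_of_mul_eq_mul_right hp0 h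
    omega
  · rw [disjoint_left]
    rintro x hx1 hx2
    obtain ⟨a, ha, rfl⟩ := mem_image.1 hx1
    obtain ⟨b, _, hab⟩ := mem_image.1 hx2
    have ha' : (a + 1) * p ≤ k + p / 2 := (Nat.le_div_iff_mul_le hp0).1 (by simpa [mem_range] using ha)
    have hpos : p ≤ (a + 1) * p := Nat.le_mul_of_pos_left p (by omega)
    generalize (a + 1) * p = P at hab ha' hpos
    generalize b * p = Q at hab
    omega

/-- **No more singular poles than singular zeros**: `#singD ≤ #singN`; precisely
`#singN − #singD = [k mod p > h] + [(n−k) mod p > h]`. [cite: LaiSprangZudilin2026, §5 (proof of Lemma 5.3)] -/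
theorem card_singN_eq [hp : Fact p.Prime] (hp2 : p ≠ 2) {n k : ℕ} (hk : k ≤ n) :
    (singN p n k).card = (singD p n k).card +
      ((if k % p ≤ p / 2 then 0 else 1) + (if (n - k) % p ≤ p / 2 then 0 else 1)) := by
  rw [card_singN hp2 hk, card_singD hk, add_half_div hp2, add_half_div hp2]
  ring

/-- The GOOD poles: both last digits `≤ h`. [cite: LaiSprangZudilin2026, §5] -/
def Good (p n k : ℕ) : Prop := k % p ≤ p / 2 ∧ (n - k) % p ≤ p / 2


/-- `#singN = #singD` iff the pole is good; otherwise `#singN ≥ #singD + 1`. [cite: LaiSprangZudilin2026, §5] -/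
theorem card_cases [hp : Fact p.Prime] (hp2 : p ≠ 2) {n k : ℕ} (hk : k ≤ n) :
    (Good p n k → (singN p n k).card = (singD p n k).card) ∧
    (¬ Good p n k → (singD p n k).card + 1 ≤ (singN p n k).card) := by
  have h := card_singN_eq hp2 hk (p := p)
  unfold Good
  constructor
  · rintro ⟨h1, h2⟩; rw [h, if_pos h1, if_pos h2]; rfl
  · intro hng
    rw [h]
    by_cases h1 : k % p ≤ p / 2
    · have h2 : ¬ (n - k) % p ≤ p / 2 := fun h2 => hng ⟨h1, h2⟩
      rw [if_pos h1, if_neg h2]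
    · rw [if_neg h1]; split_ifs <;> omega

/-! ### Consequences for `TF` and for `pTaylor (R_n(t)(t+k)^4)` -/

/-- `TF` is `p`-integral (`k ≤ n`, `2n < p²`). [cite: LaiSprangZudilin2026, §5 (proof of Lemma 5.3: "for trivial reasons … ≥ −3")] -/
theorem TF_psOrdGe [hp : Fact p.Prime] (hp2 : p ≠ 2) {n k : ℕ} (hk : k ≤ n) (hn : 2 * n < p ^ 2) :
    PSOrdGe p 0 (TF p n k) ∧ (¬ Good p n k → PSOrdGe p 1 (TF p n k)) ∧
    (Good p n k → PSOrdGe p 1 (TF p n k - C ((2 : ℚ) ^ (2 * n) * uval p n k) * Mpart p n k)) := by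
  have hp0 : (p : ℚ) ≠ 0 := by exact_mod_cast hp.out.ne_zero
  obtain ⟨hU0, hU1⟩ := Upart_psOrdGe hp2 n k (p := p)
  have hM0 := Mpart_psOrdGe hp2 hk hn
  have h2n : PSOrdGe p 0 (C ((2 : ℚ) ^ (2 * n))) := PSOrdGe.C (by simpa using PadicOrdGe.of_nat (p := p) (2 ^ (2 * n)))
  obtain ⟨hgood, hbad⟩ := card_cases hp2 hk (p := p)
  set s₁ := (singN p n k).card
  set s₂ := (singD p n k).card
  -- the scalar `p^{s₁} p^{-s₂}`
  have hscal : ∀ {d : ℕ}, s₂ + d ≤ s₁ →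
      PSOrdGe p d (C ((p : ℚ) ^ s₁ * ((p : ℚ)⁻¹) ^ s₂)) := by
    intro d hd
    refine PSOrdGe.C (PadicOrdGe.of_eq ?_)
    rw [inv_pow, ← pow_sub₀ _ hp0 (by omega : s₂ ≤ s₁), padicValRat.pow, padicValRat.self hp.out.one_lt,
      mul_one]
    exact_mod_cast (by omega : d ≤ s₁ - s₂)
  have hTF := TF_eq n hk (p := p)
  refine ⟨?_, fun hng => ?_, fun hg => ?_⟩
  · rw [hTF]
    have hle : s₂ + 0 ≤ s₁ := by
      by_cases hg : Good p n k
      · have := hgood hg; omega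
      · have := hbad hg; omega
    simpa using ((h2n.mul (hscal hle)).mul hU0).mul hM0
  · rw [hTF]
    simpa using ((h2n.mul (hscal (d := 1) (hbad hng))).mul hU0).mul hM0
  · have hs : C ((p : ℚ) ^ s₁ * ((p : ℚ)⁻¹) ^ s₂) = 1 := by
      rw [hgood hg, inv_pow, mul_inv_cancel₀ (pow_ne_zero _ hp0), map_one]
    rw [hTF, hs, mul_one]
    have e : C ((2 : ℚ) ^ (2 * n)) * Upart p n k * Mpart p n k - C ((2 : ℚ) ^ (2 * n) * uval p n k) * Mpart p n k
        = C ((2 : ℚ) ^ (2 * n)) * (Upart p n k - C (uval p n k)) * Mpart p n k := by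
      rw [map_mul]; ring
    rw [e]
    simpa using (h2n.mul hU1).mul hM0

/-- **The `p`-scaled Taylor series of `R_n(t)(t+k)^4` at `−k` is `p`-integral** (`p` odd, `k ≤ n`, `2n < p²`):
`ord_p r_{n,i,k} ≥ −(4−i)`. At a BAD pole it is `≡ 0 (mod p)`; at a GOOD pole it is
`≡ C((n−2k)·(2^{2n}u)^4)·ℳ^4 (mod p)`. [cite: LaiSprangZudilin2026, §5 (proof of Lemma 5.3)] -/
theorem pTaylor_Rreg_psOrdGe [hp : Fact p.Prime] (hp2 : p ≠ 2) {n k : ℕ} (hk : k ≤ n) (hn : 2 * n < p ^ 2) :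
    PSOrdGe p 0 (pTaylor p (Rreg n k) (-(k : ℚ))) ∧
    (¬ Good p n k → PSOrdGe p 1 (pTaylor p (Rreg n k) (-(k : ℚ)))) ∧
    (Good p n k → PSOrdGe p 1 (pTaylor p (Rreg n k) (-(k : ℚ)) -
      C (((n : ℚ) - 2 * k) * ((2 : ℚ) ^ (2 * n) * uval p n k) ^ 4) * Mpart p n k ^ 4)) := by
  obtain ⟨h0, hb, hg⟩ := TF_psOrdGe hp2 hk hn (p := p)
  have hw : PadicOrdGe p 0 ((n : ℚ) - 2 * k) := by
    simpa using PadicOrdGe.of_int (p := p) ((n : ℤ) - 2 * k)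
  obtain ⟨hL0, hL1⟩ := psOrdGe_lin_two hw (p := p)
  rw [pTaylor_Rreg n hk]
  refine ⟨by simpa using hL0.mul (h0.pow 4), fun hng => ?_, fun hgd => ?_⟩
  · have h4 : PSOrdGe p 1 (TF p n k ^ 4) := by
      rw [show TF p n k ^ 4 = TF p n k * TF p n k ^ 3 by ring]
      simpa using (hb hng).mul (h0.pow 3)
    simpa using hL0.mul h4
  · have hM0 := Mpart_psOrdGe hp2 hk hn
    have hc : PSOrdGe p 0 (C ((2 : ℚ) ^ (2 * n) * uval p n k) * Mpart p n k) := by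
      have : PadicOrdGe p 0 ((2 : ℚ) ^ (2 * n) * uval p n k) := by
        simpa using (PadicOrdGe.of_nat (p := p) (2 ^ (2 * n))).mul (padicOrdGe_uval hp2 n k) |> fun h => by
          push_cast at h; exact h
      simpa using (PSOrdGe.C this).mul hM0
    have h4 := PSOrdGe.pow_congr h0 hc (hg hgd) 4
    have e : C (((n : ℚ) - 2 * k) * ((2 : ℚ) ^ (2 * n) * uval p n k) ^ 4) * Mpart p n k ^ 4
        = C ((n : ℚ) - 2 * k) * (C ((2 : ℚ) ^ (2 * n) * uval p n k) * Mpart p n k) ^ 4 := by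
      rw [map_mul, map_pow]; ring
    rw [e]
    exact PSOrdGe.mul_congr hL0 (hc.pow 4) hL1 h4

end Lemma53

end Literature.NumberTheory.Irrationality.LaiSprangZudilin2026


namespace Literature.NumberTheory.Irrationality.LaiSprangZudilin2026

open Finset Filter PowerSeries Literature.Analysis.Calculus Literature.NumberTheory.Transcendental
open Literature.NumberTheory.Irrationality.RivoalZudilin2020 (halfBrick Greg Greg_eq)
open scoped Nat

namespace Lemma53

variable {p : ℕ}

/-! ### The value at the pole: `F_k(−k) = binom(2k,k)·binom(2n−2k,n−k)` -/

/-- `∏_{i<m} (i + ½) = binom(2m,m)·m!/4^m`. [cite: LaiSprangZudilin2026, §5 (proof of Lemma 5.3)] -/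
theorem prod_range_add_half (m : ℕ) :
    ∏ i ∈ range m, ((i : ℚ) + 1 / 2) = (Nat.centralBinom m : ℚ) * (m ! : ℚ) / 4 ^ m := by
  induction m with
  | zero => simp
  | succ m ih =>
    rw [prod_range_succ, ih, Nat.factorial_succ, pow_succ]
    have h := Nat.succ_mul_centralBinom_succ m
    have h' : ((m + 1 : ℕ) : ℚ) * (Nat.centralBinom (m + 1) : ℚ) = 2 * (2 * m + 1) * Nat.centralBinom m := by
      exact_mod_cast h
    push_cast at h' ⊢
    rw [div_mul_eq_mul_div, div_eq_div_iff (by positivity) (by positivity)]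
    linear_combination (-((m ! : ℚ) * 4 ^ m)) * h'

/-- `A_k := binom(2k,k)·binom(2(n−k),n−k)` (`= B_K^{1/4}` of the cell's closed forms). [cite: LaiSprangZudilin2026, §5] -/
def Aval (n k : ℕ) : ℚ := ((Nat.centralBinom k * Nat.centralBinom (n - k) : ℕ) : ℚ)

/-- The value of the half-integer brick at `−k` (`k ≤ n`):
`2^{2n}(−k+½)_n/n! = (−1)^k binom(2k,k) binom(2(n−k),n−k) k!(n−k)!/n!`. [cite: LaiSprangZudilin2026, §5 (F(t))] -/
theorem halfBrick_neg (n : ℕ) {k : ℕ} (hk : k ≤ n) :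
    halfBrick 0 n (-(k : ℚ)) =
      (-1) ^ k * (Nat.centralBinom k : ℚ) * (Nat.centralBinom (n - k) : ℚ) * ((k ! : ℚ) * ((n - k)! : ℚ)) / (n ! : ℚ) := by
  unfold halfBrick
  have e : ∀ j ∈ range n, (-(k : ℚ) + (((0 : ℤ) : ℚ) + 1 / 2 + j)) = ((j : ℚ) - k + 1 / 2) :=
    fun j _ => by push_cast; ring
  rw [prod_congr rfl e, ← prod_range_mul_prod_Ico _ hk]
  -- the first block, reflected
  have h1 : ∏ j ∈ range k, ((j : ℚ) - k + 1 / 2) = (-1) ^ k * ∏ i ∈ range k, ((i : ℚ) + 1 / 2) := by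
    rw [← prod_range_reflect (fun i => ((i : ℚ) - k + 1 / 2)) k]
    have e2 : ∀ j ∈ range k, (((k - 1 - j : ℕ) : ℚ) - k + 1 / 2) = (-1) * ((j : ℚ) + 1 / 2) := by
      intro j hj
      have hj' := mem_range.1 hj
      rw [Nat.cast_sub (by omega), Nat.cast_sub (by omega)]; push_cast; ring
    rw [prod_congr rfl e2, prod_mul_distrib, prod_const, card_range]
  -- the second block, shifted
  have h2 : ∏ j ∈ Ico k n, ((j : ℚ) - k + 1 / 2) = ∏ i ∈ range (n - k), ((i : ℚ) + 1 / 2) := by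
    rw [prod_Ico_eq_prod_range]
    refine prod_congr rfl fun i _ => ?_
    push_cast; ring
  rw [h1, h2, prod_range_add_half, prod_range_add_half]
  have h4 : (4 : ℚ) ^ k * 4 ^ (n - k) = 2 ^ (2 * n) := by
    rw [← pow_add, Nat.add_sub_cancel' hk, pow_mul]; norm_num
  have hf : (n ! : ℚ) ≠ 0 := by exact_mod_cast Nat.factorial_ne_zero n
  field_simp
  rw [← h4]; ring

/-- The value of `G(t)(t+k) = n!/∏_{l≠k}(t+l)` at `−k`: `(−1)^k n!/(k!(n−k)!)`. [cite: LaiSprangZudilin2026, §5 (G(t))] -/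
theorem Greg_neg (n : ℕ) {k : ℕ} (hk : k ≤ n) :
    Greg n k (-(k : ℚ)) = (-1) ^ k * (n ! : ℚ) / ((k ! : ℚ) * ((n - k)! : ℚ)) := by
  rw [Greg_eq n hk]
  have hsplit : (range (n + 1)).filter (fun l => l ≠ k) = range k ∪ Ico (k + 1) (n + 1) := by
    ext l; simp only [mem_filter, mem_range, mem_union, mem_Ico]; omega
  have hdisj : Disjoint (range k) (Ico (k + 1) (n + 1)) := by
    rw [disjoint_left]; intro l h1 h2; simp only [mem_range] at h1; simp only [mem_Ico] at h2; omega
  rw [hsplit, prod_union hdisj, prod_inv_distrib, prod_inv_distrib]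
  have h1 : ∏ l ∈ range k, (-(k : ℚ) + l) = (-1) ^ k * (k ! : ℚ) := by
    rw [← prod_range_reflect (fun l => (-(k : ℚ) + l)) k]
    have e2 : ∀ j ∈ range k, (-(k : ℚ) + ((k - 1 - j : ℕ) : ℚ)) = (-1) * ((j : ℚ) + 1) := by
      intro j hj
      have hj' := mem_range.1 hj
      rw [Nat.cast_sub (by omega), Nat.cast_sub (by omega)]; push_cast; ring
    rw [prod_congr rfl e2, prod_mul_distrib, prod_const, card_range, ← prod_range_add_one_eq_factorial]
    push_cast; rfl
  have h2 : ∏ l ∈ Ico (k + 1) (n + 1), (-(k : ℚ) + l) = ((n - k)! : ℚ) := by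
    rw [prod_Ico_eq_prod_range, show n + 1 - (k + 1) = n - k by omega, ← prod_range_add_one_eq_factorial,
      Nat.cast_prod]
    refine prod_congr rfl fun i _ => ?_
    push_cast; ring
  rw [h1, h2]
  have hf1 : (k ! : ℚ) ≠ 0 := by exact_mod_cast Nat.factorial_ne_zero k
  have hf2 : ((n - k)! : ℚ) ≠ 0 := by exact_mod_cast Nat.factorial_ne_zero (n - k)
  have hs : ((-1 : ℚ) ^ k)⁻¹ = (-1) ^ k := by rw [← inv_pow, inv_neg, inv_one]
  rw [mul_inv, hs]
  field_simp

/-- **The value identity** `F_k(−k) = binom(2k,k)·binom(2(n−k),n−k)` (`= A_k`): the constant coefficient of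
`TF`. [cite: LaiSprangZudilin2026, §5] -/
theorem halfBrick_mul_Greg (n : ℕ) {k : ℕ} (hk : k ≤ n) :
    halfBrick 0 n (-(k : ℚ)) * Greg n k (-(k : ℚ)) = Aval n k := by
  rw [halfBrick_neg n hk, Greg_neg n hk, Aval]
  have hf : (n ! : ℚ) ≠ 0 := by exact_mod_cast Nat.factorial_ne_zero n
  have hf1 : (k ! : ℚ) ≠ 0 := by exact_mod_cast Nat.factorial_ne_zero k
  have hf2 : ((n - k)! : ℚ) ≠ 0 := by exact_mod_cast Nat.factorial_ne_zero (n - k)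
  have hs : ((-1 : ℚ) ^ k) * (-1) ^ k = 1 := by rw [← mul_pow]; norm_num
  push_cast
  field_simp
  linear_combination ((Nat.centralBinom k : ℚ) * (Nat.centralBinom (n - k) : ℚ)) * hs

/-- `constantCoeff TF = A_k`. [cite: LaiSprangZudilin2026, §5] -/
theorem constantCoeff_TF (n : ℕ) {k : ℕ} (hk : k ≤ n) : constantCoeff (TF p n k) = Aval n k := by
  rw [TF, map_mul, constantCoeff_pTaylor, constantCoeff_pTaylor, halfBrick_mul_Greg n hk]

/-! ### Good poles: the normalised model `Λ(k/p)` -/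

/-- At a good pole, `2^{2n}·u = A_k · mval⁻¹`. [cite: LaiSprangZudilin2026, §5] -/
theorem good_scalar [hp : Fact p.Prime] (hp2 : p ≠ 2) {n k : ℕ} (hk : k ≤ n) (hn : 2 * n < p ^ 2) (hg : Good p n k) :
    (2 : ℚ) ^ (2 * n) * uval p n k = Aval n k * (mval p n k)⁻¹ := by
  have hp0 : (p : ℚ) ≠ 0 := by exact_mod_cast hp.out.ne_zero
  have hm := (padicOrdGe_mval hp2 hk hn).2.2
  have hs := (card_cases hp2 hk (p := p)).1 hg
  have h := congrArg constantCoeff (TF_eq n hk (p := p))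
  rw [constantCoeff_TF n hk, map_mul, map_mul, map_mul, constantCoeff_C, constantCoeff_C, constantCoeff_Upart,
    constantCoeff_Mpart, hs, inv_pow, mul_inv_cancel₀ (pow_ne_zero _ hp0), mul_one] at h
  rw [eq_mul_inv_iff_mul_eq₀ hm, h]

/-- The singular part in DIGIT coordinates: for lower/upper singular zeros `β' = ∓(2j+1)/2` and lower/upper singular
poles `β = ∓(j+1)`. [cite: LaiSprangZudilin2026, §5 (proof of Lemma 5.3)] -/
def Mstar (a b c d : ℕ) : ℚ⟦X⟧ :=
  ((∏ j ∈ range a, (C (-((2 * (j : ℚ) + 1) / 2)) + X)) * ∏ j ∈ range b, (C ((2 * (j : ℚ) + 1) / 2) + X)) *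
    ((∏ j ∈ range c, invLin 1 (-((j : ℚ) + 1))) * ∏ j ∈ range d, invLin 1 ((j : ℚ) + 1))

/-- `ℳ = Mstar((k+h)/p, (n−k+h)/p, k/p, (n−k)/p)`. [cite: LaiSprangZudilin2026, §5] -/
theorem Mpart_eq_Mstar [hp : Fact p.Prime] (hp2 : p ≠ 2) {n k : ℕ} (hk : k ≤ n) :
    Mpart p n k = Mstar ((k + p / 2) / p) ((n - k + p / 2) / p) (k / p) ((n - k) / p) := by
  have hp0 : 0 < p := hp.out.pos
  have hp0' : (p : ℚ) ≠ 0 := by exact_mod_cast hp.out.ne_zero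
  have hodd := two_mul_half_add_one hp2
  have hoddQ : (2 : ℚ) * (p / 2 : ℕ) + 1 = p := by exact_mod_cast hodd
  rw [Mpart, Mstar, singN_eq hp2 hk, singD_eq hk, prod_union, prod_union, prod_image, prod_image, prod_image,
    prod_image]
  · congr 1
    · congr 1
      · refine prod_congr rfl fun j hj => ?_
        have hjp : (j + 1) * p ≤ k + p / 2 := (Nat.le_div_iff_mul_le hp0).1 (by simpa [mem_range] using hj)
        have e : wN k (k + p / 2 - (j + 1) * p) = (p : ℚ) * (-((2 * (j : ℚ) + 1) / 2)) := by
          rw [wN, Nat.cast_sub hjp]; push_cast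
          linear_combination (1 / 2 : ℚ) * hoddQ
        rw [e, mul_div_cancel_left₀ _ hp0']
      · refine prod_congr rfl fun j _ => ?_
        have e : wN k (k + p / 2 + j * p) = (p : ℚ) * ((2 * (j : ℚ) + 1) / 2) := by
          rw [wN]; push_cast
          linear_combination (1 / 2 : ℚ) * hoddQ
        rw [e, mul_div_cancel_left₀ _ hp0']
    · congr 1
      · refine prod_congr rfl fun j hj => ?_
        have hjp : (j + 1) * p ≤ k := (Nat.le_div_iff_mul_le hp0).1 (by simpa [mem_range] using hj)
        have e : wD k (k - (j + 1) * p) = (p : ℚ) * (-((j : ℚ) + 1)) := by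
          rw [wD, Nat.cast_sub hjp]; push_cast; ring
        rw [e, mul_div_cancel_left₀ _ hp0']
      · refine prod_congr rfl fun j _ => ?_
        have e : wD k (k + (j + 1) * p) = (p : ℚ) * ((j : ℚ) + 1) := by
          rw [wD]; push_cast; ring
        rw [e, mul_div_cancel_left₀ _ hp0']
  -- injectivity and disjointness side goals (in the order generated)
  · intro a _ b _ hab
    have h : (a + 1) * p = (b + 1) * p := by simp only at hab; omega
    have := Nat.eq_of_mul_eq_mul_right hp0 h
    omega
  · intro a ha b hb hab
    have ha' : (a + 1) * p ≤ k := (Nat.le_div_iff_mul_le hp0).1 (by simpa [mem_range] using ha)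
    have hb' : (b + 1) * p ≤ k := (Nat.le_div_iff_mul_le hp0).1 (by simpa [mem_range] using hb)
    have h : (a + 1) * p = (b + 1) * p := by
      simp only at hab
      generalize (a + 1) * p = P at hab ha'
      generalize (b + 1) * p = Q at hab hb'
      omega
    have := Nat.eq_of_mul_eq_mul_right hp0 h
    omega
  · intro a _ b _ hab
    have h : a * p = b * p := by simp only at hab; omega
    exact Nat.eq_of_mul_eq_mul_right hp0 h
  · intro a ha b hb hab
    have ha' : (a + 1) * p ≤ k + p / 2 := (Nat.le_div_iff_mul_le hp0).1 (by simpa [mem_range] using ha)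
    have hb' : (b + 1) * p ≤ k + p / 2 := (Nat.le_div_iff_mul_le hp0).1 (by simpa [mem_range] using hb)
    have h : (a + 1) * p = (b + 1) * p := by
      simp only at hab
      generalize (a + 1) * p = P at hab ha'
      generalize (b + 1) * p = Q at hab hb'
      omega
    have := Nat.eq_of_mul_eq_mul_right hp0 h
    omega
  · rw [disjoint_left]
    rintro x hx1 hx2
    obtain ⟨a, ha, rfl⟩ := mem_image.1 hx1
    obtain ⟨b, _, hab⟩ := mem_image.1 hx2
    have ha' : (a + 1) * p ≤ k := (Nat.le_div_iff_mul_le hp0).1 (by simpa [mem_range] using ha)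
    have hpos : p ≤ (a + 1) * p := Nat.le_mul_of_pos_left p (by omega)
    generalize (a + 1) * p = P at hab ha' hpos
    generalize (b + 1) * p = Q at hab
    omega
  · rw [disjoint_left]
    rintro x hx1 hx2
    obtain ⟨a, ha, rfl⟩ := mem_image.1 hx1
    obtain ⟨b, _, hab⟩ := mem_image.1 hx2
    have ha' : (a + 1) * p ≤ k + p / 2 := (Nat.le_div_iff_mul_le hp0).1 (by simpa [mem_range] using ha)
    have hpos : p ≤ (a + 1) * p := Nat.le_mul_of_pos_left p (by omega)
    generalize (a + 1) * p = P at hab ha' hpos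
    generalize b * p = Q at hab
    omega

/-- **`Λ(q)`** — the normalised fourth power of the singular part of a good pole with leading digit `q = k/p`
(it depends on `k` only through `q`). [cite: LaiSprangZudilin2026, §5 (proof of Lemma 5.3)] -/
def Lam (p n q : ℕ) : ℚ⟦X⟧ :=
  (Mstar q (n / p - q) q (n / p - q) * C (constantCoeff (Mstar q (n / p - q) q (n / p - q)))⁻¹) ^ 4

/-- At a good pole the model is `C((n−2k)A_k^4)·Λ(k/p)`. [cite: LaiSprangZudilin2026, §5 (proof of Lemma 5.3)] -/
theorem model_good [hp : Fact p.Prime] (hp2 : p ≠ 2) {n k : ℕ} (hk : k ≤ n) (hn : 2 * n < p ^ 2) (hg : Good p n k) :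
    C (((n : ℚ) - 2 * k) * ((2 : ℚ) ^ (2 * n) * uval p n k) ^ 4) * Mpart p n k ^ 4 =
      C (((n : ℚ) - 2 * k) * Aval n k ^ 4) * Lam p n (k / p) := by
  obtain ⟨_, hdq, _⟩ := digits_of_good hp2 hk hg.1 hg.2
  have h1 : (k + p / 2) / p = k / p := by rw [add_half_div hp2, if_pos hg.1, add_zero]
  have h2 : (n - k + p / 2) / p = n / p - k / p := by rw [add_half_div hp2, if_pos hg.2, add_zero, hdq]
  have hM : Mpart p n k = Mstar (k / p) (n / p - k / p) (k / p) (n / p - k / p) := by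
    rw [Mpart_eq_Mstar hp2 hk, h1, h2, hdq]
  have hc : mval p n k = constantCoeff (Mstar (k / p) (n / p - k / p) (k / p) (n / p - k / p)) := by
    rw [← constantCoeff_Mpart, hM]
  rw [good_scalar hp2 hk hn hg, Lam, ← hc, ← hM, map_mul, map_mul, map_pow, map_pow, map_mul]
  ring

/-- `Mstar a b c d` and the inverse of its constant coefficient are `p`-integral when `a, b, c, d ≤ n/p` with
`2n < p²` (all the `β`'s are `p`-adic units). [cite: LaiSprangZudilin2026, §5 (proof of Lemma 5.3)] -/
theorem psOrdGe_Mstar [hp : Fact p.Prime] (hp2 : p ≠ 2) {n a b c d : ℕ} (hn : 2 * n < p ^ 2)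
    (ha : a ≤ n / p) (hb : b ≤ n / p) (hc : c ≤ n / p) (hd : d ≤ n / p) :
    PSOrdGe p 0 (Mstar a b c d) ∧ PadicOrdGe p 0 (constantCoeff (Mstar a b c d))⁻¹ := by
  have hp0 : 0 < p := hp.out.pos
  -- `2(n/p) < p`
  have hsmall : 2 * (n / p) < p := by
    have h1 : n / p * p ≤ n := Nat.div_mul_le_self n p
    have : 2 * (n / p) * p < p * p := by rw [sq] at hn; nlinarith
    exact Nat.lt_of_mul_lt_mul_right this
  have hodd_unit : ∀ j : ℕ, j < n / p → PadicOrdGe p 0 ((2 * (j : ℚ) + 1) / 2) ∧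
      PadicOrdGe p 0 ((2 * (j : ℚ) + 1) / 2)⁻¹ := by
    intro j hj
    have hnd : ¬ p ∣ 2 * j + 1 := Nat.not_dvd_of_pos_of_lt (by omega) (by omega)
    have hnd' : ¬ (p : ℤ) ∣ ((2 * j + 1 : ℕ) : ℤ) := fun h => hnd (by exact_mod_cast h)
    constructor
    · rw [div_eq_mul_inv]
      simpa using (PadicOrdGe.of_nat (p := p) (2 * j + 1)).mul (padicOrdGe_half hp2) |> fun h => by
        push_cast at h; exact h
    · rw [inv_div, div_eq_mul_inv]
      have h1 : PadicOrdGe p 0 (((2 * j + 1 : ℕ) : ℚ))⁻¹ := by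
        have := PadicOrdGe.inv_of_int (p := p) (c := ((2 * j + 1 : ℕ) : ℤ)) (m := 0)
          (by rw [padicValInt.eq_zero_of_not_dvd hnd'])
        simpa using this
      push_cast at h1
      simpa using (PadicOrdGe.of_nat (p := p) 2).mul h1
  have hsucc_unit : ∀ j : ℕ, j < n / p → PadicOrdGe p 0 ((j : ℚ) + 1) ∧ PadicOrdGe p 0 ((j : ℚ) + 1)⁻¹ := by
    intro j hj
    have hnd : ¬ p ∣ j + 1 := Nat.not_dvd_of_pos_of_lt (by omega) (by omega)
    have hnd' : ¬ (p : ℤ) ∣ ((j + 1 : ℕ) : ℤ) := fun h => hnd (by exact_mod_cast h)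
    constructor
    · simpa using PadicOrdGe.of_nat (p := p) (j + 1)
    · have := PadicOrdGe.inv_of_int (p := p) (c := ((j + 1 : ℕ) : ℤ)) (m := 0)
        (by rw [padicValInt.eq_zero_of_not_dvd hnd'])
      simpa using this
  have hneg : ∀ {x : ℚ} {v : ℤ}, PadicOrdGe p v x → PadicOrdGe p v (-x) := by
    intro x v h
    rcases h with h | h
    · exact Or.inl (by rw [h, neg_zero])
    · exact Or.inr (by rwa [padicValRat.neg])
  have hS1 : PSOrdGe p 0 (∏ j ∈ range a, (C (-((2 * (j : ℚ) + 1) / 2)) + X)) :=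
    PSOrdGe.prod _ fun j hj => by
      have hj' : j < n / p := lt_of_lt_of_le (mem_range.1 hj) ha
      exact (PSOrdGe.C (hneg (hodd_unit j hj').1)).add (PSOrdGe.X p)
  have hS2 : PSOrdGe p 0 (∏ j ∈ range b, (C ((2 * (j : ℚ) + 1) / 2) + X)) :=
    PSOrdGe.prod _ fun j hj => by
      have hj' : j < n / p := lt_of_lt_of_le (mem_range.1 hj) hb
      exact (PSOrdGe.C (hodd_unit j hj').1).add (PSOrdGe.X p)
  have hS3 : PSOrdGe p 0 (∏ j ∈ range c, invLin 1 (-((j : ℚ) + 1))) :=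
    PSOrdGe.prod _ fun j hj => by
      have hj' : j < n / p := lt_of_lt_of_le (mem_range.1 hj) hc
      exact psOrdGe_invLin_one (by rw [inv_neg]; exact hneg (hsucc_unit j hj').2)
  have hS4 : PSOrdGe p 0 (∏ j ∈ range d, invLin 1 ((j : ℚ) + 1)) :=
    PSOrdGe.prod _ fun j hj => by
      have hj' : j < n / p := lt_of_lt_of_le (mem_range.1 hj) hd
      exact psOrdGe_invLin_one (hsucc_unit j hj').2
  have hT1 : PadicOrdGe p 0 (∏ j ∈ range a, (-((2 * (j : ℚ) + 1) / 2))⁻¹) := by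
    simpa using PadicOrdGe.prod (p := p) (s := range a) (v := fun _ => (0 : ℤ))
      (f := fun j => (-((2 * (j : ℚ) + 1) / 2))⁻¹) fun j hj => by
        have hj' : j < n / p := lt_of_lt_of_le (mem_range.1 hj) ha
        rw [inv_neg]; exact hneg (hodd_unit j hj').2
  have hT2 : PadicOrdGe p 0 (∏ j ∈ range b, ((2 * (j : ℚ) + 1) / 2)⁻¹) := by
    simpa using PadicOrdGe.prod (p := p) (s := range b) (v := fun _ => (0 : ℤ))
      (f := fun j => ((2 * (j : ℚ) + 1) / 2)⁻¹) fun j hj => by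
        have hj' : j < n / p := lt_of_lt_of_le (mem_range.1 hj) hb
        exact (hodd_unit j hj').2
  have hT3 : PadicOrdGe p 0 (∏ j ∈ range c, (-((j : ℚ) + 1))) := by
    simpa using PadicOrdGe.prod (p := p) (s := range c) (v := fun _ => (0 : ℤ))
      (f := fun j => (-((j : ℚ) + 1))) fun j hj => by
        have hj' : j < n / p := lt_of_lt_of_le (mem_range.1 hj) hc
        exact hneg (hsucc_unit j hj').1
  have hT4 : PadicOrdGe p 0 (∏ j ∈ range d, ((j : ℚ) + 1)) := by
    simpa using PadicOrdGe.prod (p := p) (s := range d) (v := fun _ => (0 : ℤ))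
      (f := fun j => ((j : ℚ) + 1)) fun j hj => by
        have hj' : j < n / p := lt_of_lt_of_le (mem_range.1 hj) hd
        exact (hsucc_unit j hj').1
  constructor
  · rw [Mstar]
    simpa using (hS1.mul hS2).mul (hS3.mul hS4)
  · have e : (constantCoeff (Mstar a b c d))⁻¹ =
        ((∏ j ∈ range a, (-((2 * (j : ℚ) + 1) / 2))⁻¹) * ∏ j ∈ range b, ((2 * (j : ℚ) + 1) / 2)⁻¹) *
          ((∏ j ∈ range c, (-((j : ℚ) + 1))) * ∏ j ∈ range d, ((j : ℚ) + 1)) := by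
      simp only [Mstar, map_mul, map_prod, map_add, constantCoeff_C, constantCoeff_X, add_zero,
        constantCoeff_invLin, mul_inv, prod_inv_distrib, inv_inv]
    rw [e]
    simpa using (hT1.mul hT2).mul (hT3.mul hT4)

/-- **`Λ(q)` is `p`-integral** for `q ≤ n/p` (`2n < p²`). [cite: LaiSprangZudilin2026, §5 (proof of Lemma 5.3)] -/
theorem psOrdGe_Lam [hp : Fact p.Prime] (hp2 : p ≠ 2) {n q : ℕ} (hn : 2 * n < p ^ 2) (hq : q ≤ n / p) :
    PSOrdGe p 0 (Lam p n q) := by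
  obtain ⟨h0, hc⟩ := psOrdGe_Mstar hp2 hn hq (Nat.sub_le _ _) hq (Nat.sub_le _ _) (a := q) (c := q)
    (b := n / p - q) (d := n / p - q)
  rw [Lam]
  simpa using (h0.mul (PSOrdGe.C hc)).pow 4

/-! ### Bad poles: `p ∣ A_k` (Kummer/Lucas) -/

/-- A digit `> h` produces a carry: `p ∣ binom(2m, m)` if `m mod p > p/2`. [cite: LaiSprangZudilin2026, §5 (proof of Lemma 5.3: "p ∤ binom(2m,m) ⇒ (m mod p) ≤ (p−1)/2")] -/
theorem dvd_centralBinom_of_digit [hp : Fact p.Prime] (hp2 : p ≠ 2) {m : ℕ} (h : p / 2 < m % p) :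
    p ∣ Nat.centralBinom m := by
  have hp0 : 0 < p := hp.out.pos
  have hodd := two_mul_half_add_one hp2
  have hr : m % p < p := Nat.mod_lt _ hp0
  have hL := Choose.choose_modEq_choose_mod_mul_choose_div_nat (n := 2 * m) (k := m) (p := p)
  have hmod : (2 * m) % p = 2 * (m % p) - p := by
    have e : 2 * m = (2 * (m % p) - p) + p * (2 * (m / p) + 1) := by
      have := Nat.div_add_mod m p
      have e3 : p * (2 * (m / p) + 1) = 2 * (p * (m / p)) + p := by ring
      omega
    rw [e, Nat.add_mul_mod_self_left, Nat.mod_eq_of_lt (by omega)]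
  rw [Nat.centralBinom_eq_two_mul_choose, ← Nat.modEq_zero_iff_dvd]
  refine hL.trans ?_
  rw [hmod, Nat.choose_eq_zero_of_lt (by omega), zero_mul]

/-- Lucas for a good digit: `binom(2m,m) ≡ binom(2(m mod p), m mod p)·binom(2(m/p), m/p) (mod p)` when
`m mod p ≤ p/2`. [cite: LaiSprangZudilin2026, §5 (proof of Lemma 5.3)] -/
theorem centralBinom_modEq_of_digit [hp : Fact p.Prime] (hp2 : p ≠ 2) {m : ℕ} (h : m % p ≤ p / 2) :
    Nat.centralBinom m ≡ Nat.centralBinom (m % p) * Nat.centralBinom (m / p) [MOD p] := by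
  have hp0 : 0 < p := hp.out.pos
  have hodd := two_mul_half_add_one hp2
  have hL := Choose.choose_modEq_choose_mod_mul_choose_div_nat (n := 2 * m) (k := m) (p := p)
  have e : 2 * m = p * (2 * (m / p)) + 2 * (m % p) := by
    have := Nat.div_add_mod m p
    have e3 : p * (2 * (m / p)) = 2 * (p * (m / p)) := by ring
    omega
  have hlt : 2 * (m % p) < p := by omega
  have hmod : (2 * m) % p = 2 * (m % p) := by rw [e, Nat.mul_add_mod_self_left, Nat.mod_eq_of_lt hlt]
  have hdiv : (2 * m) / p = 2 * (m / p) := by rw [e, Nat.mul_add_div hp0, Nat.div_eq_of_lt hlt, add_zero]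
  rw [Nat.centralBinom_eq_two_mul_choose, Nat.centralBinom_eq_two_mul_choose, Nat.centralBinom_eq_two_mul_choose]
  rwa [hmod, hdiv] at hL

/-- At a BAD pole `p ∣ A_k`, so `ord_p A_k ≥ 1`. [cite: LaiSprangZudilin2026, §5 (proof of Lemma 5.3)] -/
theorem padicOrdGe_Aval_bad [hp : Fact p.Prime] (hp2 : p ≠ 2) {n k : ℕ} (hb : ¬ Good p n k) :
    PadicOrdGe p 1 (Aval n k) := by
  have hdvd : p ∣ Nat.centralBinom k * Nat.centralBinom (n - k) := by
    unfold Good at hb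
    rcases not_and_or.1 hb with h | h
    · exact (dvd_centralBinom_of_digit hp2 (not_le.1 h)).mul_right _
    · exact (dvd_centralBinom_of_digit hp2 (not_le.1 h)).mul_left _
  have hne : Nat.centralBinom k * Nat.centralBinom (n - k) ≠ 0 :=
    mul_ne_zero (Nat.centralBinom_ne_zero k) (Nat.centralBinom_ne_zero (n - k))
  refine PadicOrdGe.of_eq ?_
  rw [Aval, padicValRat.of_nat]
  exact_mod_cast one_le_padicValNat_of_dvd hne hdvd

/-! ### The per-pole congruence -/

/-- **The `p`-scaled Taylor series of `R_n(t)(t+k)^4` at `−k` modulo `p`** (`p` odd prime, `k ≤ n`, `2n < p²`):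
it is `p`-integral and `≡ C((n−2k)·A_k^4)·Λ(k/p) (mod p)` — the units digit of `k` enters only through the scalar
`(n−2k)A_k^4`. [cite: LaiSprangZudilin2026, §5 (proof of Lemma 5.3)] -/
theorem pTaylor_Rreg_congr [hp : Fact p.Prime] (hp2 : p ≠ 2) {n k : ℕ} (hk : k ≤ n) (hn : 2 * n < p ^ 2) :
    PSOrdGe p 0 (pTaylor p (Rreg n k) (-(k : ℚ))) ∧
    PSOrdGe p 1 (pTaylor p (Rreg n k) (-(k : ℚ)) - C (((n : ℚ) - 2 * k) * Aval n k ^ 4) * Lam p n (k / p)) := by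
  obtain ⟨h0, hb, hg⟩ := pTaylor_Rreg_psOrdGe hp2 hk hn (p := p)
  refine ⟨h0, ?_⟩
  by_cases hgood : Good p n k
  · rw [← model_good hp2 hk hn hgood]; exact hg hgood
  · have hL := psOrdGe_Lam hp2 hn (Nat.div_le_div_right hk) (p := p)
    have hA : PadicOrdGe p 1 (((n : ℚ) - 2 * k) * Aval n k ^ 4) := by
      have h1 : PadicOrdGe p 0 ((n : ℚ) - 2 * k) := by simpa using PadicOrdGe.of_int (p := p) ((n : ℤ) - 2 * k)
      have h2 := (padicOrdGe_Aval_bad hp2 hgood).pow 4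
      exact (h1.mul h2).mono (by norm_num)
    have := (PSOrdGe.C hA).mul hL
    simpa using (hb hgood).sub (by simpa using this)

end Lemma53

end Literature.NumberTheory.Irrationality.LaiSprangZudilin2026

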